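import Summits.Ventures.PercRepro.RankLevelSetFrameQ
import Summits.Ventures.PercRepro.RankLevelSetTheoremC
import Summits.Ventures.PercRepro.S2CoreSeventeenSplit

/-!
# PercRepro — THE ALL-AT-ONCE COLOOP DEVICE (p8 g13, S3)

For a finite matroid `M`, a finite set `K` of coloops of `M` (`k = |K|`) and `M₀ = M ＼ K`, every `A ⊆ E` splits as
`(A ∩ K, A ∖ K)` with `r(A) = r₀(A ∖ K) + |A ∩ K|`. Hence the level counts of `M` are the binomial convolution of those
of `M₀` — `W_u(M) = Σ_{i ≤ k} C(k, i) · W_{u−i}(M₀)` — and the window count of `M` is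
`#Y_M(p, q) = Σ_{i ≤ k} C(k, i) · #{A₀ ⊆ E₀ : q < r₀(A₀) + i < p}`, while `#U_M(p, q) = #U_{M₀}(p − k, q)`.
So `RLS M p q` follows from ONE inequality about the coloop-free part `M₀` (`RLS_of_coloops_device`): the terminal that
every coloop chain of the cells needs, in place of an «every-core» cell at a lower rank. The terms `i ≥ q + 1` of the
sum are all of `2^{|E₀|}` (every shifted rank is `> q`), which is what makes the device close at every number of coloops.

Vocabulary: `shiftCount M t u = #{A ⊆ E : r(A) + t = u} = W_{u−t}(M)` (`0` for `t > u`), so that the one-coloop step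
`shiftCount M t u = shiftCount (M ＼ {e}) t u + shiftCount (M ＼ {e}) (t+1) u` holds at every `t, u` without a separate
case `u = 0`; `midShift M i p q = #{A ⊆ E : q < r(A) + i < p}`.

Axioms: standard.
-/

open Set
open scoped Matroid

namespace PercRepro

namespace Matroid

variable {α : Type*} {M : _root_.Matroid α}

/-- The shifted level count `#{A ⊆ E : r(A) + t = u} = W_{u−t}(M)` (`0` when `t > u`). -/
noncomputable def shiftCount (M : _root_.Matroid α) (t u : ℕ) : ℕ :=
  if t ≤ u then levelCount M (u - t) else 0

/-- The shifted window count `#{A ⊆ E : q < r(A) + i < p}`. -/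
noncomputable def midShift (M : _root_.Matroid α) (i p q : ℕ) : ℕ :=
  {A : Set α | A ⊆ M.E ∧ (q : ℕ∞) < M.eRk A + (i : ℕ∞) ∧ M.eRk A + (i : ℕ∞) < (p : ℕ∞)}.ncard

/-- At shift `0` the shifted level count is the level count. -/
theorem shiftCount_zero (M : _root_.Matroid α) (u : ℕ) : shiftCount M 0 u = levelCount M u := by
  simp [shiftCount]

/-- At shift `0` the shifted window count is `#Y(p, q)`. -/
theorem midShift_zero (M : _root_.Matroid α) (p q : ℕ) : midShift M 0 p q = midCount M p q := by
  simp [midShift, midCount]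

/-- A coloop `e ∉ D` of `M` is a coloop of `M ＼ D`. -/
theorem isColoop_delete_of_isColoop {e : α} (he : M.IsColoop e) {D : Set α} (heD : e ∉ D) :
    (M ＼ D).IsColoop e := by
  rw [_root_.Matroid.delete_isColoop_iff]
  exact ⟨he.notMem_closure_of_notMem (fun h => h.2 rfl), he.mem_ground, heD⟩

variable [M.Finite]

/-- **The one-coloop step at every shift**: `W^{(t)}_u(M) = W^{(t)}_u(M ＼ e) + W^{(t+1)}_u(M ＼ e)`. -/
theorem shiftCount_eq_of_isColoop {e : α} (he : M.IsColoop e) (t u : ℕ) :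
    shiftCount M t u = shiftCount (M ＼ {e}) t u + shiftCount (M ＼ {e}) (t + 1) u := by
  unfold shiftCount
  by_cases htu : t ≤ u
  · rcases Nat.lt_or_ge t u with hlt | hge
    · have h1 : t + 1 ≤ u := hlt
      rw [if_pos htu, if_pos htu, if_pos h1]
      obtain ⟨v, hv⟩ : ∃ v, u - t = v + 1 := ⟨u - t - 1, by omega⟩
      have hv' : u - (t + 1) = v := by omega
      rw [hv, hv', levelCount_succ_eq_of_isColoop he v]
    · have hte : t = u := le_antisymm htu hge
      subst hte
      rw [if_pos le_rfl, if_pos le_rfl, if_neg (by omega), Nat.sub_self,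
        levelCount_zero_eq_of_isColoop he, add_zero]
  · rw [if_neg htu, if_neg htu, if_neg (by omega)]

/-- The Pascal step of the binomial convolution. -/
theorem sum_choose_succ_shift (f : ℕ → ℕ) (k t : ℕ) :
    ∑ i ∈ Finset.range (k + 1 + 1), (k + 1).choose i * f (t + i) =
      ∑ i ∈ Finset.range (k + 1), k.choose i * f (t + i) +
        ∑ i ∈ Finset.range (k + 1), k.choose i * f (t + (i + 1)) := by
  have hL : ∑ i ∈ Finset.range (k + 1 + 1), (k + 1).choose i * f (t + i) =
      ∑ i ∈ Finset.range (k + 1), k.choose i * f (t + (i + 1)) +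
        ∑ i ∈ Finset.range (k + 1), k.choose (i + 1) * f (t + (i + 1)) + f t := by
    rw [Finset.sum_range_succ']
    simp only [Nat.choose_succ_succ, add_mul, Finset.sum_add_distrib, Nat.choose_zero_right, one_mul,
      add_zero]
  have hR : ∑ i ∈ Finset.range (k + 1), k.choose i * f (t + i) =
      ∑ i ∈ Finset.range k, k.choose (i + 1) * f (t + (i + 1)) + f t := by
    rw [Finset.sum_range_succ']
    simp only [Nat.choose_zero_right, one_mul, add_zero]
  have hT : ∑ i ∈ Finset.range (k + 1), k.choose (i + 1) * f (t + (i + 1)) =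
      ∑ i ∈ Finset.range k, k.choose (i + 1) * f (t + (i + 1)) := by
    rw [Finset.sum_range_succ, Nat.choose_succ_self, zero_mul, add_zero]
  rw [hL, hR, hT]
  ring

/-- **The binomial convolution**: for a finite set `K` of coloops of `M`,
`W^{(t)}_u(M) = Σ_{i ≤ |K|} C(|K|, i) · W^{(t+i)}_u(M ＼ K)`. -/
theorem shiftCount_eq_sum_delete (K : Finset α) (hK : ∀ e ∈ K, M.IsColoop e) (t u : ℕ) :
    shiftCount M t u =
      ∑ i ∈ Finset.range (K.card + 1), K.card.choose i * shiftCount (M ＼ (K : Set α)) (t + i) u := by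
  classical
  induction K using Finset.induction_on generalizing t with
  | empty => simp
  | insert e K heK ih =>
    have hKe : ∀ x ∈ K, M.IsColoop x := fun x hx => hK x (Finset.mem_insert_of_mem hx)
    have he : M.IsColoop e := hK e (Finset.mem_insert_self e K)
    have he' : (M ＼ (K : Set α)).IsColoop e := isColoop_delete_of_isColoop he (by simpa using heK)
    have hdel : M ＼ ((insert e K : Finset α) : Set α) = (M ＼ (K : Set α)) ＼ {e} := by
      rw [_root_.Matroid.delete_delete, Finset.coe_insert, Set.insert_eq, Set.union_comm]
    rw [Finset.card_insert_of_notMem heK, hdel, ih hKe t]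
    have hstep : ∀ i, shiftCount (M ＼ (K : Set α)) (t + i) u =
        shiftCount ((M ＼ (K : Set α)) ＼ {e}) (t + i) u +
          shiftCount ((M ＼ (K : Set α)) ＼ {e}) (t + (i + 1)) u := by
      intro i
      have := shiftCount_eq_of_isColoop he' (t + i) u
      rwa [Nat.add_assoc] at this
    simp only [hstep, mul_add, Finset.sum_add_distrib]
    exact (sum_choose_succ_shift (fun j => shiftCount ((M ＼ (K : Set α)) ＼ {e}) j u) K.card t).symm

omit [M.Finite] in
/-- The rank drops by one per deleted coloop: `r(M ＼ K) + |K| = r(M)`. -/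
theorem eRank_delete_coloops (K : Finset α) (hK : ∀ e ∈ K, M.IsColoop e) :
    (M ＼ (K : Set α)).eRank + (K.card : ℕ∞) = M.eRank := by
  classical
  induction K using Finset.induction_on with
  | empty => simp
  | insert e K heK ih =>
    have hKe : ∀ x ∈ K, M.IsColoop x := fun x hx => hK x (Finset.mem_insert_of_mem hx)
    have he : M.IsColoop e := hK e (Finset.mem_insert_self e K)
    have he' : (M ＼ (K : Set α)).IsColoop e := isColoop_delete_of_isColoop he (by simpa using heK)
    have hdel : M ＼ ((insert e K : Finset α) : Set α) = (M ＼ (K : Set α)) ＼ {e} := by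
      rw [_root_.Matroid.delete_delete, Finset.coe_insert, Set.insert_eq, Set.union_comm]
    rw [Finset.card_insert_of_notMem heK, hdel, ← ih hKe, ← eRank_delete_add_one he']
    push_cast
    ring

omit [M.Finite] in
/-- `r(M ＼ K) = p − |K|` when `r(M) = p` (and `|K| ≤ p`). -/
theorem eRank_delete_coloops_eq (K : Finset α) (hK : ∀ e ∈ K, M.IsColoop e) {p : ℕ}
    (hR : M.eRank = (p : ℕ∞)) :
    (M ＼ (K : Set α)).eRank = ((p - K.card : ℕ) : ℕ∞) ∧ K.card ≤ p := by
  have h := eRank_delete_coloops K hK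
  rw [hR] at h
  have hk : K.card ≤ p := by
    have : (K.card : ℕ∞) ≤ (p : ℕ∞) := le_add_self.trans h.le
    exact_mod_cast this
  refine ⟨?_, hk⟩
  have h2 : (M ＼ (K : Set α)).eRank + (K.card : ℕ∞) = ((p - K.card : ℕ) : ℕ∞) + (K.card : ℕ∞) := by
    rw [h, ← Nat.cast_add, Nat.sub_add_cancel hk]
  exact WithTop.add_right_cancel (ENat.coe_ne_top K.card) h2

/-- `#U_M(p, q+1) = #U_{M ＼ K}(p − |K|, q+1)` for a finite set `K` of coloops. -/
theorem topCount_delete_coloops (K : Finset α) (hK : ∀ e ∈ K, M.IsColoop e) {p : ℕ} (q : ℕ)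
    (hR : M.eRank = (p : ℕ∞)) :
    topCount M p (q + 1) = topCount (M ＼ (K : Set α)) (p - K.card) (q + 1) := by
  classical
  induction K using Finset.induction_on with
  | empty => simp
  | insert e K heK ih =>
    have hKe : ∀ x ∈ K, M.IsColoop x := fun x hx => hK x (Finset.mem_insert_of_mem hx)
    have he : M.IsColoop e := hK e (Finset.mem_insert_self e K)
    have he' : (M ＼ (K : Set α)).IsColoop e := isColoop_delete_of_isColoop he (by simpa using heK)
    have hdel : M ＼ ((insert e K : Finset α) : Set α) = (M ＼ (K : Set α)) ＼ {e} := by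
      rw [_root_.Matroid.delete_delete, Finset.coe_insert, Set.insert_eq, Set.union_comm]
    obtain ⟨hRK, hk⟩ := eRank_delete_coloops_eq K hKe hR
    -- the coloop `e` of `M ＼ K` forces `p − |K| ≥ 1`
    have hpos : 1 ≤ p - K.card := by
      have h1 := eRank_delete_add_one he'
      rw [hRK] at h1
      by_contra hcon
      have h0 : p - K.card = 0 := by omega
      rw [h0] at h1
      have : (1 : ℕ∞) ≤ 0 := by
        calc (1 : ℕ∞) ≤ ((M ＼ (K : Set α)) ＼ {e}).eRank + 1 := le_add_self
          _ = ((0 : ℕ) : ℕ∞) := h1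
          _ = 0 := by simp
      exact absurd this (by decide)
    have hRK' : (M ＼ (K : Set α)).eRank = ((p - K.card - 1 + 1 : ℕ) : ℕ∞) := by
      rw [hRK]; congr 1; omega
    have hpk : p - K.card = p - K.card - 1 + 1 := by omega
    rw [Finset.card_insert_of_notMem heK, hdel, ih hKe, hpk, topCount_eq_of_isColoop_of_eRank he' q hRK',
      Nat.sub_sub]

omit [M.Finite] in
/-- `#{A ⊆ E : r(A) + i = p} = W^{(i)}_p(M)`. -/
theorem ncard_shift_eq (i p : ℕ) :
    {A : Set α | A ⊆ M.E ∧ M.eRk A + (i : ℕ∞) = (p : ℕ∞)}.ncard = shiftCount M i p := by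
  unfold shiftCount
  by_cases hip : i ≤ p
  · rw [if_pos hip]
    unfold levelCount
    congr 1
    ext A
    simp only [Set.mem_setOf_eq]
    constructor
    · rintro ⟨hA, h⟩
      refine ⟨hA, ?_⟩
      have h2 : M.eRk A + (i : ℕ∞) = ((p - i : ℕ) : ℕ∞) + (i : ℕ∞) := by
        rw [h, ← Nat.cast_add, Nat.sub_add_cancel hip]
      exact WithTop.add_right_cancel (ENat.coe_ne_top i) h2
    · rintro ⟨hA, h⟩
      refine ⟨hA, ?_⟩
      rw [h, ← Nat.cast_add, Nat.sub_add_cancel hip]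
  · rw [if_neg hip]
    have hempty : {A : Set α | A ⊆ M.E ∧ M.eRk A + (i : ℕ∞) = (p : ℕ∞)} = ∅ := by
      ext A
      simp only [Set.mem_setOf_eq, Set.mem_empty_iff_false, iff_false, not_and]
      intro _ h
      have h1 : (i : ℕ∞) ≤ M.eRk A + (i : ℕ∞) := le_add_self
      rw [h] at h1
      have h2 : (p : ℕ) < i := by omega
      have h3 : (p : ℕ∞) < (i : ℕ∞) := by exact_mod_cast h2
      exact absurd (h1.trans_lt h3) (lt_irrefl _)
    rw [hempty, Set.ncard_empty]

/-- `#Y^{(i)}(p + 1, q) = #Y^{(i)}(p, q) + W^{(i)}_p` for `q < p`. -/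
theorem midShift_succ (i p q : ℕ) (hqp : q < p) :
    midShift M i (p + 1) q = midShift M i p q + shiftCount M i p := by
  unfold midShift
  rw [← ncard_shift_eq]
  have hsplit : {A : Set α | A ⊆ M.E ∧ (q : ℕ∞) < M.eRk A + (i : ℕ∞) ∧
      M.eRk A + (i : ℕ∞) < ((p + 1 : ℕ) : ℕ∞)} =
      {A : Set α | A ⊆ M.E ∧ (q : ℕ∞) < M.eRk A + (i : ℕ∞) ∧ M.eRk A + (i : ℕ∞) < (p : ℕ∞)} ∪
      {A : Set α | A ⊆ M.E ∧ M.eRk A + (i : ℕ∞) = (p : ℕ∞)} := by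
    ext A
    simp only [Set.mem_setOf_eq, Set.mem_union]
    constructor
    · rintro ⟨hA, h1, h2⟩
      rw [Nat.cast_succ, ENat.lt_add_one_iff (ENat.coe_ne_top p)] at h2
      rcases h2.lt_or_eq with h2 | h2
      · exact Or.inl ⟨hA, h1, h2⟩
      · exact Or.inr ⟨hA, h2⟩
    · rintro (⟨hA, h1, h2⟩ | ⟨hA, h2⟩)
      · exact ⟨hA, h1, h2.trans (by exact_mod_cast Nat.lt_succ_self p)⟩
      · refine ⟨hA, ?_, ?_⟩
        · rw [h2]; exact_mod_cast hqp
        · rw [h2]; exact_mod_cast Nat.lt_succ_self p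
  have hdisj : Disjoint
      {A : Set α | A ⊆ M.E ∧ (q : ℕ∞) < M.eRk A + (i : ℕ∞) ∧ M.eRk A + (i : ℕ∞) < (p : ℕ∞)}
      {A : Set α | A ⊆ M.E ∧ M.eRk A + (i : ℕ∞) = (p : ℕ∞)} := by
    rw [Set.disjoint_left]
    rintro A ⟨_, _, h2⟩ ⟨_, h3⟩
    rw [h3] at h2
    exact lt_irrefl _ h2
  rw [hsplit, Set.ncard_union_eq hdisj (M.ground_finite.finite_subsets.subset fun A hA => hA.1)
    (M.ground_finite.finite_subsets.subset fun A hA => hA.1)]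

/-- `#Y^{(i)}(q + 1, q) = 0`. -/
theorem midShift_succ_self (i q : ℕ) : midShift M i (q + 1) q = 0 := by
  unfold midShift
  rw [Set.ncard_eq_zero (M.ground_finite.finite_subsets.subset fun A hA => hA.1)]
  ext A
  simp only [Set.mem_setOf_eq, Set.mem_empty_iff_false, iff_false, not_and]
  intro _ h1 h2
  rw [Nat.cast_succ, ENat.lt_add_one_iff (ENat.coe_ne_top q)] at h2
  exact absurd h1 (not_lt.mpr h2)

/-- **`#Y^{(i)}(p, q) = Σ_{q<u<p} W^{(i)}_u`** for `q < p`. -/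
theorem midShift_eq_sum (i p q : ℕ) (hqp : q < p) :
    midShift M i p q = ∑ u ∈ Finset.Ioo q p, shiftCount M i u := by
  have hqp' : q + 1 ≤ p := hqp
  clear hqp
  induction p, hqp' using Nat.le_induction with
  | base =>
    rw [midShift_succ_self]
    have : Finset.Ioo q (q + 1) = ∅ := by
      ext x; simp only [Finset.mem_Ioo, Finset.notMem_empty, iff_false]; omega
    rw [this, Finset.sum_empty]
  | succ p hqp ih =>
    rw [midShift_succ i p q hqp, ih]
    have : Finset.Ioo q (p + 1) = insert p (Finset.Ioo q p) := by ext x; simp; omega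
    rw [this, Finset.sum_insert (by simp)]
    ring

/-- **THE DEVICE IDENTITY**: `#Y_M(p, q) = Σ_{i ≤ |K|} C(|K|, i) · #Y^{(i)}_{M ＼ K}(p, q)` for a finite set `K` of
coloops of `M` and `q < p`. -/
theorem midCount_eq_sum_midShift_delete (K : Finset α) (hK : ∀ e ∈ K, M.IsColoop e) {p q : ℕ}
    (hqp : q < p) :
    midCount M p q =
      ∑ i ∈ Finset.range (K.card + 1), K.card.choose i * midShift (M ＼ (K : Set α)) i p q := by
  rw [midCount_eq_sum p q hqp]
  have h1 : ∀ u ∈ Finset.Ioo q p, levelCount M u =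
      ∑ i ∈ Finset.range (K.card + 1), K.card.choose i * shiftCount (M ＼ (K : Set α)) i u := by
    intro u _
    rw [← shiftCount_zero, shiftCount_eq_sum_delete K hK 0 u]
    simp only [Nat.zero_add]
  rw [Finset.sum_congr rfl h1, Finset.sum_comm]
  refine Finset.sum_congr rfl fun i _ => ?_
  rw [midShift_eq_sum i p q hqp, Finset.mul_sum]

/-- **`2^n ≤ #Y^{(i)}(p, q) + #{r + i ≤ q} + #{p ≤ r + i}`**: every subset of `E` has shifted rank `≤ q`, in `(q, p)`,
or `≥ p`. -/
theorem two_pow_le_midShift_add (i p q : ℕ) :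
    2 ^ M.ground_finite.toFinset.card ≤ midShift M i p q +
      {X : Set α | X ⊆ M.E ∧ M.eRk X + (i : ℕ∞) ≤ q}.ncard +
      {X : Set α | X ⊆ M.E ∧ (p : ℕ∞) ≤ M.eRk X + (i : ℕ∞)}.ncard := by
  have hE : (M.ground_finite.toFinset : Set α) = M.E := Set.Finite.coe_toFinset _
  have hsub : {X : Set α | X ⊆ (M.ground_finite.toFinset : Set α)} ⊆
      ({A : Set α | A ⊆ M.E ∧ (q : ℕ∞) < M.eRk A + (i : ℕ∞) ∧ M.eRk A + (i : ℕ∞) < (p : ℕ∞)} ∪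
        {X : Set α | X ⊆ M.E ∧ M.eRk X + (i : ℕ∞) ≤ q}) ∪
        {X : Set α | X ⊆ M.E ∧ (p : ℕ∞) ≤ M.eRk X + (i : ℕ∞)} := by
    intro X hX
    rw [hE] at hX
    by_cases h1 : M.eRk X + (i : ℕ∞) ≤ q
    · exact Or.inl (Or.inr ⟨hX, h1⟩)
    · by_cases h2 : M.eRk X + (i : ℕ∞) < p
      · exact Or.inl (Or.inl ⟨hX, not_le.1 h1, h2⟩)
      · exact Or.inr ⟨hX, not_lt.1 h2⟩
  have hfin : ∀ P : Set α → Prop, {X : Set α | X ⊆ M.E ∧ P X}.Finite :=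
    fun P => M.ground_finite.finite_subsets.subset (fun X hX => hX.1)
  calc 2 ^ M.ground_finite.toFinset.card = {X : Set α | X ⊆ (M.ground_finite.toFinset : Set α)}.ncard :=
        (ncard_subsets_eq _).symm
    _ ≤ (({A : Set α | A ⊆ M.E ∧ (q : ℕ∞) < M.eRk A + (i : ℕ∞) ∧ M.eRk A + (i : ℕ∞) < (p : ℕ∞)} ∪
          {X : Set α | X ⊆ M.E ∧ M.eRk X + (i : ℕ∞) ≤ q}) ∪
          {X : Set α | X ⊆ M.E ∧ (p : ℕ∞) ≤ M.eRk X + (i : ℕ∞)}).ncard :=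
        Set.ncard_le_ncard hsub (((hfin _).union (hfin _)).union (hfin _))
    _ ≤ ({A : Set α | A ⊆ M.E ∧ (q : ℕ∞) < M.eRk A + (i : ℕ∞) ∧ M.eRk A + (i : ℕ∞) < (p : ℕ∞)} ∪
          {X : Set α | X ⊆ M.E ∧ M.eRk X + (i : ℕ∞) ≤ q}).ncard +
          {X : Set α | X ⊆ M.E ∧ (p : ℕ∞) ≤ M.eRk X + (i : ℕ∞)}.ncard :=
        Set.ncard_union_le _ _
    _ ≤ _ := by
        unfold midShift
        have := Set.ncard_union_le
          {A : Set α | A ⊆ M.E ∧ (q : ℕ∞) < M.eRk A + (i : ℕ∞) ∧ M.eRk A + (i : ℕ∞) < (p : ℕ∞)}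
          {X : Set α | X ⊆ M.E ∧ M.eRk X + (i : ℕ∞) ≤ q}
        omega

end Matroid

namespace ThmN

open Matroid

variable {α : Type}

/-- **THE ALL-AT-ONCE COLOOP DEVICE.** `K` a finite set of coloops of `M` (`k = |K|`), `r(M) = p`, `q + 1 < p − k`:
`RLS M p (q+1)` follows from the ONE inequality
`Φ(p, q+1) · #U_{M ＼ K}(p − k, q+1) ≤ Σ_{i ≤ k} C(k, i) · #{A ⊆ E ∖ K : q + 1 < r_{M ＼ K}(A) + i < p}`. -/
theorem RLS_of_coloops_device (M : Matroid α) [M.Finite] (K : Finset α) (hK : ∀ e ∈ K, M.IsColoop e)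
    {p q : ℕ} (hqp : q + 1 < p) (hR : M.eRank = (p : ℕ∞))
    (h : phiK p (q + 1) * (Matroid.topCount (M ＼ (K : Set α)) (p - K.card) (q + 1) : ℚ) ≤
      ∑ i ∈ Finset.range (K.card + 1),
        ((K.card.choose i : ℕ) : ℚ) * (Matroid.midShift (M ＼ (K : Set α)) i p (q + 1) : ℚ)) :
    RLS M p (q + 1) := by
  rw [RLS_iff, Matroid.topCount_delete_coloops K hK q hR, Matroid.midCount_eq_sum_midShift_delete K hK hqp]
  push_cast
  exact h

/-- **The data of the coloop-free part**: `K` a finite set of coloops of the `e`-free core `M` (`r = p`, `|E| = p + d`):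
`M ＼ K` is an `e`-free core with `r = p − |K|`, `|E| = p − |K| + d`; and it is coloop-free when `K` holds every
coloop of `M`. -/
theorem delete_coloops_core_data (M : Matroid α) [M.Finite] (K : Finset α) (hK : ∀ e ∈ K, M.IsColoop e)
    {p d : ℕ} (hR : M.eRank = (p : ℕ∞)) (hn : M.E.ncard = p + d)
    (hfree : ∀ e ∈ M.E, ∃ A ⊆ M.E \ {e}, e ∉ M.closure A ∧ e ∉ M.closure ((M.E \ {e}) \ A)) :
    (M ＼ (K : Set α)).E.ncard = p - K.card + d ∧ (M ＼ (K : Set α)).eRank = ((p - K.card : ℕ) : ℕ∞) ∧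
      (∀ x ∈ (M ＼ (K : Set α)).E, ∃ A ⊆ (M ＼ (K : Set α)).E \ {x},
        x ∉ (M ＼ (K : Set α)).closure A ∧ x ∉ (M ＼ (K : Set α)).closure (((M ＼ (K : Set α)).E \ {x}) \ A)) ∧
      K.card ≤ p := by
  classical
  induction K using Finset.induction_on with
  | empty =>
    refine ⟨by simpa using hn, by simpa using hR, by simpa using hfree, by simp⟩
  | insert e K heK ih =>
    have hKe : ∀ x ∈ K, M.IsColoop x := fun x hx => hK x (Finset.mem_insert_of_mem hx)
    have he : M.IsColoop e := hK e (Finset.mem_insert_self e K)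
    have he' : (M ＼ (K : Set α)).IsColoop e := isColoop_delete_of_isColoop he (by simpa using heK)
    have hdel : M ＼ ((insert e K : Finset α) : Set α) = (M ＼ (K : Set α)) ＼ {e} := by
      rw [_root_.Matroid.delete_delete, Finset.coe_insert, Set.insert_eq, Set.union_comm]
    obtain ⟨hnK, hRK, hfreeK, hk⟩ := ih hKe
    have hpos : 1 ≤ p - K.card := by
      have h1 := eRank_delete_add_one he'
      rw [hRK] at h1
      by_contra hcon
      have h0 : p - K.card = 0 := by omega
      rw [h0] at h1
      have : (1 : ℕ∞) ≤ 0 := by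
        calc (1 : ℕ∞) ≤ ((M ＼ (K : Set α)) ＼ {e}).eRank + 1 := le_add_self
          _ = ((0 : ℕ) : ℕ∞) := h1
          _ = 0 := by simp
      exact absurd this (by decide)
    have hRK' : (M ＼ (K : Set α)).eRank = ((p - K.card - 1 + 1 : ℕ) : ℕ∞) := by
      rw [hRK]; congr 1; omega
    have hnK' : (M ＼ (K : Set α)).E.ncard = p - K.card - 1 + 1 + d := by rw [hnK]; omega
    obtain ⟨h1, h2, h3, -⟩ := delete_core_data (M ＼ (K : Set α)) he' hRK' hnK' hfreeK
    rw [Finset.card_insert_of_notMem heK, hdel]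
    refine ⟨by rw [h1]; omega, by rw [h2, Nat.sub_sub], h3, by omega⟩

end ThmN

end PercRepro
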